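import Literature.NumberTheory.EllipticCurves.IwasawaNakayamaProofs
import Literature.NumberTheory.EllipticCurves.IwasawaEulerCharDualityProofs
import Literature.NumberTheory.EllipticCurves.IwasawaAlgebraPseudoNullProofs
import Summits.BirchSwinnertonDyer.Rank1Residual.X2.MuVanishingOfFiniteModP
import Summits.BirchSwinnertonDyer.Rank1Residual.X2.DualRestrictionInvariants
import Summits.BirchSwinnertonDyer.Rank1Residual.X2.SelmerCotorsionOfFiniteTorsion
import Mathlib.LinearAlgebra.FreeModule.ModN
import HarnessLib

/-!
# Three pieces of `Λ`-algebra for Pontryagin duals: the converse Nakayama lemma for a dual pair,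
# "`M/pM` finite ⇒ `M` is `Λ`-torsion", and `μ`, `λ` along a surjection with `(ker)/p` finite

HONEST FRAMING (cell `b2b-bsdres`, run/shared/lean/b2b/bsd-rank1-residual/, verbatim in every
file): the goal of the cell is to DELETE the COMBINATION-SHAPED residual classes of the
Birch–Swinnerton-Dyer formula for ALL analytic-rank `≤ 1` elliptic curves over `ℚ` — "full BSD
formula for every rank `≤ 1` curve in class `C`" assembled STRICTLY from published theorems — so
that the rank-`≤ 1` remainder becomes exactly the CONSTRUCTION-SHAPED classes, which are TYPED
(missing-input `Prop`s), NOT attempted. This is not "finishing BSD". Team n1011 (N10/N11; row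
T-GV23-PA = the located gap P-α of the A240 derivation): research routes on CONSTRUCTION-SHAPED
classes; prove what is provable now; no claim beyond stated classes; census output = EVIDENCE,
never a Literature fact; RESIDUAL-MAP marks UNCHANGED; nothing is booked by this file. PURE
ALGEBRA over `Λ = ℤ_p⟦T⟧`, TOOL THEOREMS ONLY: no definition, no named fact, curve-free.

## What

* **`finite_piece_one_of_isDualPair_of_moduleFinite`** (§1) — the CONVERSE of the tree's
  Nakayama lemma `IsDualPair.module_finite` (`IwasawaNakayamaProofs`): for an axiomatic Pontryagin
  dual pair `toDual : X ≃ Hom(S, ℚ/ℤ)`, `T ↦ ψ`, if `X` is finitely generated over `Λ` then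
  `S[𝔪] = S_1 = {s | p s = 0, ψ s = 0}` is finite: restriction `X ↠ Hom(S_1, ℚ/ℤ)` (onto by the
  injectivity of `ℚ/ℤ`, Mathlib `CharacterModule.dual_surjective_of_injective`) kills `𝔪 X`
  (the two identities `T_smul`, `C_smul`), `X/𝔪X` is finite (`Λ/𝔪 = 𝔽_p`,
  `IwasawaAlgebra.finite_quotient_maximalIdeal`), and a group with finite character group is finite
  (`PontryaginCard.finite_of_finite_characterModule`). Greenberg LNM 1716 §1 p. 60 ("`X/𝔪X` is
  finite"), read backwards.
* **`isTorsion_of_finite_modN`** (§2) — a finitely generated `Λ`-module `M` with `M/pM` finite is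
  `Λ`-torsion: THE X2 LINEAGE'S `X2.SelmerCotorsionOfFiniteTorsion.isTorsion_of_finite_modN`
  (eisenstein-p2; Cayley–Hamilton for `T^k` with image in `(p)M`), consumed BY NAME here (referee-1
  ACK-1 proviso (vii) on row T-GV23-PA; this file originally re-proved it — corrected in this
  proof-only re-land; statements unchanged). Washington §13.2.
* **`mu_eq_and_lambda_le_of_surjective_of_finite_modN_ker`** (§3; with the named steps
  `moduleFinite_ker`, `isTorsion_ker`) — along a `Λ`-linear surjection
  `π : X₀ ↠ X` of a finitely generated torsion module whose kernel has `(ker π)/p` finite: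
  `μ(X₀) = μ(X)` and `λ(X) ≤ λ(X₀)` (X2's `DualRestrictionInvariants.{mu,lambda}Invariant_eq_add_of_surjective`
  and `MuVanishingOfFiniteModP.muInvariant_eq_zero_of_finite_modN` on `ker π`). GV 2000 Cor. (2.3)
  ("The `μ`-invariants of `S^{Σ₀}_A(ℚ_∞)^` and `S_A(ℚ_∞)^` are equal") in the form the cell can prove.

Consumer: the sibling `DatumSelmerNonPrimitiveInvariants` (END of row T-GV23-PA).

References: R. Greenberg, LNM 1716 (1999) §1 p. 60; L. Washington, *Introduction to Cyclotomic
Fields*, §13.2; S. Lang, *Cyclotomic Fields I–II*, Ch. 5 §1; R. Greenberg, V. Vatsal, Invent.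
Math. 142 (2000) §2 Cor. (2.3).
-/

noncomputable section

open scoped Classical

universe u v

namespace Summit.BirchSwinnertonDyer.Rank1Residual.Iwasawa

open Literature.NumberTheory.EllipticCurves Literature.NumberTheory.EllipticCurves.IwasawaDual
  PowerSeries

/-! ## §1. Converse Nakayama for a dual pair: `X` f.g. ⇒ `S[𝔪]` finite -/

section ConverseNakayama

variable {p : ℕ} [Fact p.Prime] {S : Type u} [AddCommGroup S] {ψ : AddMonoid.End S}
  {X : Type v} [AddCommGroup X] [Module (PowerSeries ℤ_[p]) X]
  {toDual : X →+ (S →+ AddCircle (1 : ℚ))}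

/-- In a dual pair, `𝔪 X` kills `S_1 = S[p] ∩ ker ψ`: for `r ∈ 𝔪 = (p, T)` and `s` with `p s = 0`,
`ψ s = 0`, `toDual (r • x) s = 0` (`r = C a + T g` with `p ∣ a`; `T_smul`, `C_smul` at `k = 1`).
[folklore] -/
theorem toDual_smul_apply_eq_zero_of_mem_maximalIdeal_of_isDualPair (h : IsDualPair p ψ toDual)
    {r : PowerSeries ℤ_[p]} (hr : r ∈ IsLocalRing.maximalIdeal (PowerSeries ℤ_[p])) (x : X)
    {s : S} (hs : s ∈ piece p ψ 1) : toDual (r • x) s = 0 := by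
  obtain ⟨hps, hψs⟩ := mem_piece.1 hs
  rw [pow_one] at hps hψs
  -- `r = T g + C a` with `a = r(0)` a non-unit of `ℤ_p`
  set g : PowerSeries ℤ_[p] := PowerSeries.mk fun n ↦ PowerSeries.coeff (n + 1) r
  set a : ℤ_[p] := PowerSeries.constantCoeff r with ha
  have hr' : r = PowerSeries.X * g + PowerSeries.C a := PowerSeries.eq_X_mul_shift_add_const r
  have ha' : (PadicInt.toZModPow 1 a).val = 0 := by
    have hna : ¬ IsUnit a := by
      intro hu
      rw [IsLocalRing.mem_maximalIdeal, mem_nonunits_iff] at hr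
      exact hr (PowerSeries.isUnit_iff_constantCoeff.mpr hu)
    have hdvd : (p : ℤ_[p]) ∣ a := by
      rwa [← PadicInt.norm_lt_one_iff_dvd, ← PadicInt.mem_nonunits]
    obtain ⟨b, hb⟩ := hdvd
    rw [ZMod.val_eq_zero, hb, map_mul, map_natCast,
      (ZMod.natCast_eq_zero_iff p (p ^ 1)).2 (by rw [pow_one]), zero_mul]
  rw [hr', add_smul, map_add, AddMonoidHom.add_apply, mul_smul, h.T_smul, hψs, map_zero,
    zero_add, h.C_smul a x s 1 (by rw [pow_one, hps]), ha', zero_smul]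

/-- **Converse Nakayama for a dual pair: `X` finitely generated over `Λ` ⇒ `S[𝔪]` finite**
(`S[𝔪] = S_1 = {s | p s = 0 ∧ ψ s = 0}`). Restriction of characters `X ≅ Hom(S, ℚ/ℤ) ↠ Hom(S_1, ℚ/ℤ)`
is onto (injectivity of `ℚ/ℤ`), kills `𝔪X`, and `X/𝔪X` is a finitely generated module over the
finite field `Λ/𝔪`, hence finite; a group with finite character group is finite. Greenberg LNM 1716
§1 p. 60 ("`X/𝔪X` is finite", the dual statement). [cite: GreenbergLNM1716, §1 p. 60 (after Conj. 1.3)] -/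
theorem finite_piece_one_of_isDualPair_of_moduleFinite (h : IsDualPair p ψ toDual)
    [Module.Finite (PowerSeries ℤ_[p]) X] : Finite (piece p ψ 1) := by
  set 𝔪 : Ideal (PowerSeries ℤ_[p]) := IsLocalRing.maximalIdeal (PowerSeries ℤ_[p]) with h𝔪
  -- restriction of characters to `S_1`
  let ρ : X →+ CharacterModule (piece p ψ 1) :=
    (AddMonoidHom.compHom' (piece p ψ 1).subtype).comp toDual
  have hρ_apply : ∀ (x : X) (s : piece p ψ 1), ρ x s = toDual x s := fun _ _ ↦ rfl
  have hρ : Function.Surjective ρ := by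
    intro χ
    obtain ⟨χ', hχ'⟩ := CharacterModule.dual_surjective_of_injective
      ((piece p ψ 1).subtype.toIntLinearMap) (piece p ψ 1).subtype_injective χ
    obtain ⟨x, hx⟩ := h.bijective.2 χ'
    refine ⟨x, ?_⟩
    ext s
    rw [hρ_apply, hx, ← hχ']
    rfl
  -- `𝔪 X ≤ ker ρ`
  have hker : (𝔪 • (⊤ : Submodule (PowerSeries ℤ_[p]) X)).toAddSubgroup ≤ ρ.ker := by
    intro x hx
    rw [AddMonoidHom.mem_ker]
    refine Submodule.smul_induction_on (p := fun y ↦ ρ y = 0) hx (fun r hr y _ ↦ ?_)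
      (fun y z hy hz ↦ by rw [map_add, hy, hz, add_zero])
    ext s
    change toDual (r • y) s = 0
    exact toDual_smul_apply_eq_zero_of_mem_maximalIdeal_of_isDualPair h hr y s.2
  -- `X/𝔪X` is finite
  haveI : Finite (X ⧸ 𝔪 • (⊤ : Submodule (PowerSeries ℤ_[p]) X)) := by
    have htors := Module.isTorsionBySet_quotient_ideal_smul X 𝔪
    letI := htors.module
    haveI : IsScalarTower (PowerSeries ℤ_[p]) (PowerSeries ℤ_[p] ⧸ 𝔪)
        (X ⧸ 𝔪 • (⊤ : Submodule (PowerSeries ℤ_[p]) X)) := htors.isScalarTower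
    haveI : Module.Finite (PowerSeries ℤ_[p] ⧸ 𝔪)
        (X ⧸ 𝔪 • (⊤ : Submodule (PowerSeries ℤ_[p]) X)) :=
      Module.Finite.of_restrictScalars_finite (PowerSeries ℤ_[p]) _ _
    haveI : Finite (PowerSeries ℤ_[p] ⧸ 𝔪) := IwasawaAlgebra.finite_quotient_maximalIdeal p
    exact Module.finite_of_finite (PowerSeries ℤ_[p] ⧸ 𝔪)
  -- `ρ` factors through `X/𝔪X`, so `Hom(S_1, ℚ/ℤ)` is finite
  let ρ' : X ⧸ (𝔪 • (⊤ : Submodule (PowerSeries ℤ_[p]) X)) →+ CharacterModule (piece p ψ 1) :=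
    QuotientAddGroup.lift _ ρ hker
  have hρ' : Function.Surjective ρ' := by
    intro χ
    obtain ⟨x, rfl⟩ := hρ χ
    exact ⟨QuotientAddGroup.mk x, rfl⟩
  haveI : Finite (CharacterModule (piece p ψ 1)) := Finite.of_surjective _ hρ'
  exact PontryaginCard.finite_of_finite_characterModule _

end ConverseNakayama

/-! ## §2. `M/pM` finite ⇒ `M` is `Λ`-torsion -/

section Torsion

variable (p : ℕ) [Fact p.Prime] (M : Type u) [AddCommGroup M] [Module (IwasawaAlgebra p) M]

/-- On a FINITE `Λ`-module some power of `T` acts as `0` (for each element the powers `Tⁱ q`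
repeat, and `1 - Tʲ` is a unit of the local ring `Λ`). This IS the X2 lineage's
`X2.SelmerCotorsionOfFiniteTorsion.exists_pow_X_smul_eq_zero_of_finite` (eisenstein-p2), consumed BY
NAME (referee-1 ACK-1 proviso (vii) on row T-GV23-PA); kept under this name only because the
sibling files of the row refer to it. [folklore] -/
theorem exists_X_pow_smul_eq_zero_of_finite (Q : Type v) [AddCommGroup Q]
    [Module (IwasawaAlgebra p) Q] [Finite Q] :
    ∃ k : ℕ, ∀ q : Q, (PowerSeries.X : IwasawaAlgebra p) ^ k • q = 0 :=
  X2.SelmerCotorsionOfFiniteTorsion.exists_pow_X_smul_eq_zero_of_finite p Q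

/-- **`M` finitely generated over `Λ` with `M/pM` finite ⇒ `M` is `Λ`-torsion.** This IS the X2
lineage's theorem `X2.SelmerCotorsionOfFiniteTorsion.isTorsion_of_finite_modN` (eisenstein-p2: some
`T^k` kills the finite `Λ`-module `M/pM`, Cayley–Hamilton for `T^k` with image in `(p)M`, reduction
modulo `p`), consumed BY NAME per referee-1 ACK-1 proviso (vii) on row T-GV23-PA (p06's tree
finding); kept under this name because `DatumSelmerNonPrimitiveInvariants` refers to it. (Dual form
of the tree's `isTorsion_of_forall_nsmul_eq_X_smul`, Greenberg LNM 1716 §1 p. 61.) Washington §13.2.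
[cite: Washington1997, §13.2] -/
theorem isTorsion_of_finite_modN [Module.Finite (IwasawaAlgebra p) M] [Finite (ModN M p)] :
    Module.IsTorsion (IwasawaAlgebra p) M :=
  X2.SelmerCotorsionOfFiniteTorsion.isTorsion_of_finite_modN p M

end Torsion

/-! ## §3. `μ` and `λ` along a surjection whose kernel has finite `(ker)/p` -/

section Surjection

variable (p : ℕ) [Fact p.Prime] {X₀ : Type u} {X : Type v} [AddCommGroup X₀]
  [Module (IwasawaAlgebra p) X₀] [AddCommGroup X] [Module (IwasawaAlgebra p) X]
  (π : X₀ →ₗ[IwasawaAlgebra p] X)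

/-- The kernel of a `Λ`-linear map out of a finitely generated `Λ`-module is finitely generated
(`Λ = ℤ_p⟦T⟧` is Noetherian: `PowerSeries.isNoetherianRing`; submodules of Noetherian modules are
finitely generated). Named step (ii) of referee-1's ACK-1 on row T-GV23-PA. [folklore] -/
theorem moduleFinite_ker [Module.Finite (IwasawaAlgebra p) X₀] :
    Module.Finite (IwasawaAlgebra p) (LinearMap.ker π) :=
  haveI : IsNoetherian (IwasawaAlgebra p) X₀ := isNoetherian_of_isNoetherianRing_of_finite _ _
  Module.IsNoetherian.finite _ _

/-- The kernel of a `Λ`-linear map out of a torsion `Λ`-module is torsion. [folklore] -/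
theorem isTorsion_ker (hX₀ : Module.IsTorsion (IwasawaAlgebra p) X₀) :
    Module.IsTorsion (IwasawaAlgebra p) (LinearMap.ker π) := fun y ↦ by
  obtain ⟨a, ha⟩ := @hX₀ (y : X₀)
  exact ⟨a, Subtype.ext (by simpa using ha)⟩

/-- **`μ(X₀) = μ(X)` and `λ(X) ≤ λ(X₀)` along a `Λ`-linear surjection `π : X₀ ↠ X` of a finitely
generated torsion `Λ`-module whose kernel has `(ker π)/p` finite**: `μ`, `λ` are additive over
`0 → ker π → X₀ → X → 0` (X2 `DualRestrictionInvariants`), `ker π` is finitely generated (`Λ`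
Noetherian) and torsion, and `μ(ker π) = 0` (X2 `MuVanishingOfFiniteModP`). The form of GV 2000
Cor. (2.3) "the `μ`-invariants of `S^{Σ₀}_A(ℚ_∞)^` and `S_A(ℚ_∞)^` are equal" provable from the
finiteness of the `p`-torsion of `S^{Σ₀}/S` alone. [cite: GreenbergVatsal2000, §2 Cor. (2.3) (arXiv:math/9906215 pp. 20–21)] -/
theorem mu_eq_and_lambda_le_of_surjective_of_finite_modN_ker [Module.Finite (IwasawaAlgebra p) X₀]
    (hX₀ : Module.IsTorsion (IwasawaAlgebra p) X₀) (hπ : Function.Surjective π)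
    [Finite (ModN (LinearMap.ker π) p)] :
    muInvariant p X₀ = muInvariant p X ∧ lambdaInvariant p X ≤ lambdaInvariant p X₀ := by
  haveI : Module.Finite (IwasawaAlgebra p) (LinearMap.ker π) := moduleFinite_ker p π
  have hK : Module.IsTorsion (IwasawaAlgebra p) (LinearMap.ker π) := isTorsion_ker p π hX₀
  have hμK : muInvariant p (LinearMap.ker π) = 0 :=
    X2.MuVanishingOfFiniteModP.muInvariant_eq_zero_of_finite_modN p (LinearMap.ker π) hK
  refine ⟨?_, ?_⟩
  · rw [X2.DualRestrictionInvariants.muInvariant_eq_add_of_surjective p π hX₀ hπ, hμK, zero_add]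
  · rw [X2.DualRestrictionInvariants.lambdaInvariant_eq_add_of_surjective p π hX₀ hπ]
    exact Nat.le_add_left _ _

end Surjection

end Summit.BirchSwinnertonDyer.Rank1Residual.Iwasawa

end
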